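import Mathlib
import Summits.MatrixMultiplication.MatrixMultiplication.Theorems.GradedDesignFamily.Negative.CuspFormTrace

/-!
# The counting wall of the quadratic-extension cell for EVERY finite field
# (crux `LevelGradedCohnUmans.GradedDesignFamily`, stmt-MatrixMultiplication-7610; negative side,
# line `quadratic-extension-level-one-cell`, stub S3 `stub_subfieldCell`)

HONEST FRAMING.  This DECIDES nothing about the summit and nothing about the asymptotic stub S3;
it is a THEOREM about the finite cells of S3, uniform in the field: a VERDICT / CERTIFICATE for the
cell census (SUBFIELD.md §0), not summit progress.

Up to now the counting wall `|Y| + |Z| ≤ (|K| + 1)(|k| − 1) (+1)` was a theorem only for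
`|k| = 3, 4, 5` (`subfieldCell_nine_wall_twenty`, `subfieldCell_sixteen_wall_sharp_any`,
`subfieldCell_twentyfive_wall_sharp_any`), each fed by a hand-picked cusp form found by
computation.  Here ONE explicit cusp form serves every finite field `k` at once:

* `ellTau s₀ = δ₂ + δ₋₂ − δ_{s₀} − δ_{−s₀}` on `k`, with `s₀` an ELLIPTIC TRACE
  (`X² − s₀ X + 1` has no root in `k`; `exists_elliptic_trace`: the traces `a + a⁻¹`, `a ≠ 0`,
  number at most `|k| − 1 < |k|`);
* the EXTENDED TRACE FORM `extTraceForm τ (M) = τ(tr M) − |k|·([M = 1] + [M = −1])` on `SL₂(k)`;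
* `extTraceForm_cusp` — it is cuspidal for every conjugate root group as soon as `Σ τ = 0` and
  `τ(a + a⁻¹) = [a = 1] + [a = −1]` (`a ≠ 0`): for `g' = [[a, β], [c, d]]`,
  `tr(g' u_x) = a + d + c x` sweeps `k` when `c ≠ 0` (and then `g' u_x ≠ ±1`), while for `c = 0`
  the trace is the constant `a + a⁻¹` and `g' u_x = ±1` happens for exactly `[a = ±1]` values of
  `x`; `ellTau_split`: the elliptic `ellTau s₀` satisfies the second condition
  (`a + a⁻¹ = ±2 ⇔ (a ∓ 1)² = 0`, and `a + a⁻¹ = ±s₀` would make `±a` a root);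
* `subfieldCell_wall_uniform` — hence, by `cuspFormWall`, for EVERY finite field `k`, every field
  `K` with `|K| = |k|²`, every injective `φ : SL₂(k) →* GL₂(K)` and all non-empty `Y, Z ⊆ GL₂(K)`
  separated as in S3: `|Y| + |Z| ≤ (|K| + 1)(|k| − 1) + 1`; `subfieldCell_area_le_uniform` —
  so `|Y|·|Z| ≤ ((|K| + 1)(|k| − 1) + 1)² / 4`.

At `|k| = 2, 3, 4, 5` this reproduces the census walls `5 (+1), 20 (+1), 51 (+1), 104 (+1)`; the
sharp value `(|K| + 1)(|k| − 1)` (no `+1`) for the algebraic embeddings is the companion file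
`SubfieldCellUniformWallSharp`.  Consistent with, and saying nothing about, S3 (`c ≤ 1/2`).

Sorry-free; axioms `propext`, `Classical.choice`, `Quot.sound`.
-/

set_option linter.dupNamespace false

open scoped BigOperators
open Matrix

namespace Summit.MatrixMultiplication.MatrixMultiplication.Theorems.GradedDesignFamily.Negative

section Forms

variable {k : Type} [Field k] [Fintype k] [DecidableEq k]

/-- An ELLIPTIC TRACE exists in every finite field: some `s₀` with `a² − s₀ a + 1 ≠ 0` for all `a`
(the map `a ↦ a + a⁻¹` on the `|k| − 1` units cannot cover `k`). [folklore] -/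
theorem exists_elliptic_trace (k : Type) [Field k] [Fintype k] :
    ∃ s₀ : k, ∀ a : k, a ^ 2 - s₀ * a + 1 ≠ 0 := by
  by_contra! h
  choose g hg using h
  have hg0 : ∀ s, g s ≠ 0 := fun s h0 => by
    have := hg s
    rw [h0] at this
    norm_num at this
  have hinj : Function.Injective g := by
    intro s t hst
    have hs := hg s
    have ht := hg t
    rw [hst] at hs
    have h0 : (s - t) * g t = 0 := by linear_combination ht - hs
    rcases mul_eq_zero.1 h0 with h0 | h0
    · exact sub_eq_zero.1 h0
    · exact absurd h0 (hg0 t)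
  obtain ⟨s, hs⟩ := Finite.surjective_of_injective hinj 0
  exact hg0 s hs

/-- The elliptic trace function `δ₂ + δ₋₂ − δ_{s₀} − δ_{−s₀}` on `k`. -/
noncomputable def ellTau (s₀ : k) (t : k) : ℂ :=
  (if t = 2 then 1 else 0) + (if t = -2 then 1 else 0) -
    (if t = s₀ then 1 else 0) - (if t = -s₀ then 1 else 0)

omit [Fintype k] in
/-- Unfolding lemma for `ellTau`. -/
theorem ellTau_apply (s₀ t : k) : ellTau s₀ t =
    (if t = 2 then 1 else 0) + (if t = -2 then 1 else 0) -
      (if t = s₀ then 1 else 0) - (if t = -s₀ then 1 else 0) := rfl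

/-- `Σ_t ellTau s₀ t = 1 + 1 − 1 − 1 = 0`. -/
theorem ellTau_sum (s₀ : k) : ∑ t : k, ellTau s₀ t = 0 := by
  simp only [ellTau_apply, Finset.sum_sub_distrib, Finset.sum_add_distrib,
    Finset.sum_ite_eq', Finset.mem_univ, if_true, sub_self, add_sub_cancel_right]

omit [Fintype k] in
/-- For an elliptic `s₀`: `ellTau s₀ (a + a⁻¹) = [a = 1] + [a = −1]` for every `a ≠ 0`. -/
theorem ellTau_split (s₀ : k) (hs₀ : ∀ a : k, a ^ 2 - s₀ * a + 1 ≠ 0) (a : k) (ha : a ≠ 0) :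
    ellTau s₀ (a + a⁻¹) = (if a = 1 then 1 else 0) + (if a = -1 then 1 else 0) := by
  have key : ∀ s : k, a + a⁻¹ = s ↔ a ^ 2 - s * a + 1 = 0 := by
    intro s
    constructor
    · intro h
      rw [← h, add_mul, inv_mul_cancel₀ ha]
      ring
    · intro h
      have h' : a * (a + a⁻¹ - s) = 0 := by
        rw [mul_sub, mul_add, mul_inv_cancel₀ ha]
        linear_combination h
      rcases mul_eq_zero.1 h' with h' | h'
      · exact absurd h' ha
      · exact sub_eq_zero.1 h'
  have e1 : a + a⁻¹ = 2 ↔ a = 1 := by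
    rw [key]
    constructor
    · intro h
      have : (a - 1) ^ 2 = 0 := by linear_combination h
      exact sub_eq_zero.1 (pow_eq_zero_iff two_ne_zero |>.1 this)
    · intro h
      rw [h]
      ring
  have e2 : a + a⁻¹ = -2 ↔ a = -1 := by
    rw [key]
    constructor
    · intro h
      have : (a + 1) ^ 2 = 0 := by linear_combination h
      exact eq_neg_of_add_eq_zero_left (pow_eq_zero_iff two_ne_zero |>.1 this)
    · intro h
      rw [h]
      ring
  have e3 : ¬ a + a⁻¹ = s₀ := fun h => hs₀ a ((key s₀).1 h)
  have e4 : ¬ a + a⁻¹ = -s₀ := by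
    intro h
    apply hs₀ (-a)
    have := (key (-s₀)).1 h
    linear_combination this
  simp only [ellTau_apply, e1, e2, e3, e4, if_false, sub_zero]

/-- The EXTENDED TRACE FORM `M ↦ τ(tr M) − |k|·([M = 1] + [M = −1])` on `SL₂(k)`. -/
noncomputable def extTraceForm (τ : k → ℂ) (M : Matrix.SpecialLinearGroup (Fin 2) k) : ℂ :=
  τ (Matrix.trace (M : Matrix (Fin 2) (Fin 2) k)) -
    (Fintype.card k : ℂ) * ((if M = 1 then 1 else 0) + (if M = -1 then 1 else 0))

/-- Unfolding lemma for `extTraceForm`. -/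
theorem extTraceForm_apply (τ : k → ℂ) (M : Matrix.SpecialLinearGroup (Fin 2) k) :
    extTraceForm τ M = τ (Matrix.trace (M : Matrix (Fin 2) (Fin 2) k)) -
      (Fintype.card k : ℂ) * ((if M = 1 then 1 else 0) + (if M = -1 then 1 else 0)) := rfl

/-- The extended trace form is a class function. -/
theorem extTraceForm_conj (τ : k → ℂ) (b M : Matrix.SpecialLinearGroup (Fin 2) k) :
    extTraceForm τ (b * M * b⁻¹) = extTraceForm τ M := by
  have e1 : b * M * b⁻¹ = 1 ↔ M = 1 := by
    rw [mul_inv_eq_iff_eq_mul, one_mul, mul_eq_left]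
  have e2 : b * M * b⁻¹ = -1 ↔ M = -1 := by
    rw [mul_inv_eq_iff_eq_mul, neg_mul, one_mul, show -b = b * -1 from (mul_neg_one b).symm,
      mul_right_inj]
  have e3 : Matrix.trace ((b * M * b⁻¹ : Matrix.SpecialLinearGroup (Fin 2) k) :
      Matrix (Fin 2) (Fin 2) k) = Matrix.trace (M : Matrix (Fin 2) (Fin 2) k) := by
    rw [Matrix.SpecialLinearGroup.coe_mul, Matrix.SpecialLinearGroup.coe_mul,
      Matrix.trace_mul_cycle, ← Matrix.SpecialLinearGroup.coe_mul, inv_mul_cancel,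
      Matrix.SpecialLinearGroup.coe_one, Matrix.one_mul]
  simp only [extTraceForm_apply, e1, e2, e3]

/-- **Extended trace sweep.**  If `Σ_t τ(t) = 0` and `τ(a + a⁻¹) = [a = 1] + [a = −1]` for every
`a ≠ 0`, then `extTraceForm τ` is cuspidal on `SL₂(k)` for every conjugate of the root group.
[folklore] -/
theorem extTraceForm_cusp (τ : k → ℂ) (h1 : ∑ t : k, τ t = 0)
    (h2 : ∀ a : k, a ≠ 0 → τ (a + a⁻¹) = (if a = 1 then 1 else 0) + (if a = -1 then 1 else 0)) :
    ∀ g b : Matrix.SpecialLinearGroup (Fin 2) k,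
      ∑ x : k, extTraceForm τ (g * b * ⟨!![(1 : k), x; 0, 1], sl2md_det_upper x⟩ * b⁻¹) = 0 := by
  intro g b
  set g' : Matrix.SpecialLinearGroup (Fin 2) k := b⁻¹ * g * b with hg'
  have hconj : ∀ x : k, g * b * ⟨!![(1 : k), x; 0, 1], sl2md_det_upper x⟩ * b⁻¹ =
      b * (g' * ⟨!![(1 : k), x; 0, 1], sl2md_det_upper x⟩) * b⁻¹ := by
    intro x
    rw [hg']
    group
  simp_rw [hconj, extTraceForm_conj]
  -- entries of `g'`
  set a : k := (g' : Matrix (Fin 2) (Fin 2) k) 0 0 with ha_def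
  set β : k := (g' : Matrix (Fin 2) (Fin 2) k) 0 1 with hβ_def
  set c : k := (g' : Matrix (Fin 2) (Fin 2) k) 1 0 with hc_def
  set d : k := (g' : Matrix (Fin 2) (Fin 2) k) 1 1 with hd_def
  have hdet : a * d - β * c = 1 := by
    have h := g'.2
    rw [Matrix.det_fin_two] at h
    exact h
  have hE : ∀ x : k, ((g' * ⟨!![(1 : k), x; 0, 1], sl2md_det_upper x⟩ :
      Matrix.SpecialLinearGroup (Fin 2) k) : Matrix (Fin 2) (Fin 2) k) =
        !![a, a * x + β; c, c * x + d] := by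
    intro x
    rw [Matrix.SpecialLinearGroup.coe_mul]
    ext i j
    fin_cases i <;> fin_cases j <;>
      simp [Matrix.mul_apply, Fin.sum_univ_two, ha_def, hβ_def, hc_def, hd_def]
  have htr' : ∀ x : k, Matrix.trace (((g' * ⟨!![(1 : k), x; 0, 1], sl2md_det_upper x⟩ :
      Matrix.SpecialLinearGroup (Fin 2) k) : Matrix (Fin 2) (Fin 2) k)) = a + d + c * x := by
    intro x
    rw [hE, Matrix.trace_fin_two_of]
    ring
  -- `g' u_x = 1`, `g' u_x = -1` in terms of the entries
  have hm1 : (((-1 : Matrix.SpecialLinearGroup (Fin 2) k) : Matrix.SpecialLinearGroup (Fin 2) k) :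
      Matrix (Fin 2) (Fin 2) k) = !![-1, 0; 0, -1] := by
    rw [Matrix.SpecialLinearGroup.coe_neg, Matrix.SpecialLinearGroup.coe_one]
    ext i j
    fin_cases i <;> fin_cases j <;> simp
  have hone : ∀ x : k, (g' * ⟨!![(1 : k), x; 0, 1], sl2md_det_upper x⟩ = 1) ↔
      ((a = 1 ∧ a * x + β = 0) ∧ (c = 0 ∧ c * x + d = 1)) := by
    intro x
    refine Subtype.ext_iff.trans ?_
    rw [hE, Matrix.SpecialLinearGroup.coe_one, Matrix.one_fin_two]
    simp only [EmbeddingLike.apply_eq_iff_eq, Matrix.vecCons_inj, and_true]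
  have hneg : ∀ x : k, (g' * ⟨!![(1 : k), x; 0, 1], sl2md_det_upper x⟩ = -1) ↔
      ((a = -1 ∧ a * x + β = 0) ∧ (c = 0 ∧ c * x + d = -1)) := by
    intro x
    refine Subtype.ext_iff.trans ?_
    rw [hE, hm1]
    simp only [EmbeddingLike.apply_eq_iff_eq, Matrix.vecCons_inj, and_true]
  by_cases hc : c = 0
  · -- constant trace `a + a⁻¹`; `g' u_x = ±1` exactly `[a = ±1]` times
    have had : a * d = 1 := by rw [hc, mul_zero, sub_zero] at hdet; exact hdet
    have ha : a ≠ 0 := left_ne_zero_of_mul_eq_one had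
    have hd : d = a⁻¹ := (inv_eq_of_mul_eq_one_right had).symm
    have hone' : ∀ x : k, (g' * ⟨!![(1 : k), x; 0, 1], sl2md_det_upper x⟩ = 1) ↔
        (a = 1 ∧ x = -β) := by
      intro x
      rw [hone x]
      constructor
      · rintro ⟨⟨h1, h2⟩, -, -⟩
        refine ⟨h1, ?_⟩
        rw [h1, one_mul] at h2
        linear_combination h2
      · rintro ⟨h1, h2⟩
        refine ⟨⟨h1, ?_⟩, hc, ?_⟩
        · rw [h1, h2]; ring
        · rw [hd, h1, hc]; simp
    have hneg' : ∀ x : k, (g' * ⟨!![(1 : k), x; 0, 1], sl2md_det_upper x⟩ = -1) ↔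
        (a = -1 ∧ x = β) := by
      intro x
      rw [hneg x]
      constructor
      · rintro ⟨⟨h1, h2⟩, -, -⟩
        refine ⟨h1, ?_⟩
        rw [h1] at h2
        linear_combination -h2
      · rintro ⟨h1, h2⟩
        refine ⟨⟨h1, ?_⟩, hc, ?_⟩
        · rw [h1, h2]; ring
        · rw [hd, h1, hc]; simp
    have S1 : ∑ x : k, (if g' * ⟨!![(1 : k), x; 0, 1], sl2md_det_upper x⟩ = 1 then (1 : ℂ)
        else 0) = if a = 1 then 1 else 0 := by
      simp_rw [hone']
      by_cases ha1 : a = 1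
      · simp [ha1]
      · simp [ha1]
    have S2 : ∑ x : k, (if g' * ⟨!![(1 : k), x; 0, 1], sl2md_det_upper x⟩ = -1 then (1 : ℂ)
        else 0) = if a = -1 then 1 else 0 := by
      simp_rw [hneg']
      by_cases ha1 : a = -1
      · simp [ha1]
      · simp [ha1]
    simp_rw [extTraceForm_apply, htr']
    rw [Finset.sum_sub_distrib, ← Finset.mul_sum, Finset.sum_add_distrib, S1, S2, ← h2 a ha]
    simp only [hc, zero_mul, add_zero]
    rw [Finset.sum_const, Finset.card_univ, hd, nsmul_eq_mul, sub_self]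
  · -- the traces sweep `k`, and `g' u_x ≠ ±1`
    have hn1 : ∀ x : k, ¬ g' * ⟨!![(1 : k), x; 0, 1], sl2md_det_upper x⟩ = 1 := by
      intro x h
      exact hc ((hone x).1 h).2.1
    have hn2 : ∀ x : k, ¬ g' * ⟨!![(1 : k), x; 0, 1], sl2md_det_upper x⟩ = -1 := by
      intro x h
      exact hc ((hneg x).1 h).2.1
    simp_rw [extTraceForm_apply, htr', hn1, hn2, if_false, add_zero, mul_zero, sub_zero]
    rw [Fintype.sum_bijective (fun x : k => a + d + c * x)
      ((Finite.injective_iff_bijective).1 fun x y hxy =>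
        mul_left_cancel₀ hc (add_left_cancel hxy)) _ τ fun x => rfl]
    exact h1

/-- The elliptic extended trace form does not vanish at the root element `u₁`. -/
theorem extTraceForm_ellTau_ne_zero (s₀ : k) (hs₀ : ∀ a : k, a ^ 2 - s₀ * a + 1 ≠ 0) :
    extTraceForm (ellTau s₀) ⟨!![(1 : k), 1; 0, 1], sl2md_det_upper 1⟩ ≠ 0 := by
  set u : Matrix.SpecialLinearGroup (Fin 2) k := ⟨!![(1 : k), 1; 0, 1], sl2md_det_upper 1⟩
    with hu
  have h1 : ¬ u = 1 := by
    intro h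
    have := congrArg (fun M : Matrix.SpecialLinearGroup (Fin 2) k =>
      (M : Matrix (Fin 2) (Fin 2) k) 0 1) h
    simp [hu] at this
  have h2 : ¬ u = -1 := by
    intro h
    have := congrArg (fun M : Matrix.SpecialLinearGroup (Fin 2) k =>
      (M : Matrix (Fin 2) (Fin 2) k) 0 1) h
    simp [hu] at this
  have htr : Matrix.trace ((u : Matrix.SpecialLinearGroup (Fin 2) k) : Matrix (Fin 2) (Fin 2) k)
      = 2 := by
    rw [hu, Matrix.trace_fin_two_of, one_add_one_eq_two]
  have h3 : ¬ (2 : k) = s₀ := by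
    intro h
    apply hs₀ 1
    rw [← h]
    ring
  have h4 : ¬ (2 : k) = -s₀ := by
    intro h
    apply hs₀ (-1)
    have : s₀ = -2 := by rw [h, neg_neg]
    rw [this]
    ring
  rw [extTraceForm_apply, if_neg h1, if_neg h2, htr, ellTau_apply]
  simp only [add_zero, mul_zero, sub_zero, h3, h4, if_false, if_true]
  split_ifs <;> norm_num

end Forms

/-- **The uniform counting wall.**  For EVERY finite field `k`, every field `K` with
`|K| = |k|²`, every injective `φ : SL₂(k) →* GL₂(K)` and all non-empty `Y, Z ⊆ GL₂(K)` separated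
from `φ(SL₂ k)` by level-one frame functions exactly as in S3:
`|Y| + |Z| ≤ (|K| + 1)(|k| − 1) + 1`.  (`cuspFormWall` with the elliptic extended trace form.)
A theorem about the finite cells; it decides nothing about S3 or the summit. [folklore] -/
theorem subfieldCell_wall_uniform {k K : Type} [Field k] [Fintype k] [DecidableEq k]
    [Field K] [Fintype K] [DecidableEq K]
    (φ : Matrix.SpecialLinearGroup (Fin 2) k →* Matrix.GeneralLinearGroup (Fin 2) K)
    (hφ : Function.Injective φ) (hK : Fintype.card K = Fintype.card k ^ 2)
    (Y Z : Finset (Matrix.GeneralLinearGroup (Fin 2) K)) (hY : Y.Nonempty) (hZ : Z.Nonempty)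
    (hsep : ∀ z₀ ∈ Z, ∃ cf : (Fin 2 → K) → (Fin 2 → K) → ℂ,
      ∀ a : Matrix.SpecialLinearGroup (Fin 2) k, ∀ y ∈ Y, ∀ y' ∈ Y, ∀ z ∈ Z,
        (∑ u : Fin 2 → K, cf u (((φ a * y * y'⁻¹ * z : Matrix.GeneralLinearGroup (Fin 2) K) :
            Matrix (Fin 2) (Fin 2) K).mulVec u)) =
          if a = 1 ∧ y = y' ∧ z = z₀ then 1 else 0) :
    Y.card + Z.card ≤ (Fintype.card K + 1) * (Fintype.card k - 1) + 1 := by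
  obtain ⟨s₀, hs₀⟩ := exists_elliptic_trace k
  exact cuspFormWall φ hφ hK Y Z hY hZ hsep (extTraceForm (ellTau s₀))
    ⟨_, extTraceForm_ellTau_ne_zero s₀ hs₀⟩
    (extTraceForm_cusp (ellTau s₀) (ellTau_sum s₀) (ellTau_split s₀ hs₀))

/-- **Uniform area bound.**  In the same configuration `4·|Y|·|Z| ≤ ((|K| + 1)(|k| − 1) + 1)²`,
for every finite field. [folklore] -/
theorem subfieldCell_area_le_uniform {k K : Type} [Field k] [Fintype k] [DecidableEq k]
    [Field K] [Fintype K] [DecidableEq K]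
    (φ : Matrix.SpecialLinearGroup (Fin 2) k →* Matrix.GeneralLinearGroup (Fin 2) K)
    (hφ : Function.Injective φ) (hK : Fintype.card K = Fintype.card k ^ 2)
    (Y Z : Finset (Matrix.GeneralLinearGroup (Fin 2) K)) (hY : Y.Nonempty) (hZ : Z.Nonempty)
    (hsep : ∀ z₀ ∈ Z, ∃ cf : (Fin 2 → K) → (Fin 2 → K) → ℂ,
      ∀ a : Matrix.SpecialLinearGroup (Fin 2) k, ∀ y ∈ Y, ∀ y' ∈ Y, ∀ z ∈ Z,
        (∑ u : Fin 2 → K, cf u (((φ a * y * y'⁻¹ * z : Matrix.GeneralLinearGroup (Fin 2) K) :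
            Matrix (Fin 2) (Fin 2) K).mulVec u)) =
          if a = 1 ∧ y = y' ∧ z = z₀ then 1 else 0) :
    4 * (Y.card * Z.card) ≤ ((Fintype.card K + 1) * (Fintype.card k - 1) + 1) ^ 2 := by
  have h := subfieldCell_wall_uniform φ hφ hK Y Z hY hZ hsep
  have h4 : 4 * (Y.card * Z.card) ≤ (Y.card + Z.card) ^ 2 := by
    zify
    nlinarith [sq_nonneg ((Y.card : ℤ) - Z.card)]
  exact h4.trans (Nat.pow_le_pow_left h 2)

end Summit.MatrixMultiplication.MatrixMultiplication.Theorems.GradedDesignFamily.Negative
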